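import Literature.AlgebraicGeometry.Resolution.FrobeniusNormIdeal
import Mathlib.LinearAlgebra.Matrix.Determinant.Basic
import HarnessLib

/-!
# The Frobenius norm module is the span of the maximal minors of the root-coordinate matrix of a set of `A^q`-generators
# (crux `FInjectiveMacaulayfication` stmt-ResolutionOfSingularities-15315, chain w45a; piece (S)-general of res-L1-w45a-lead-1 g8's TIER-2 FILE PLAN 06:27:54Z
# for LEMMA N♭; seat res-L1-w45a-stub-1 g9)

[OURS · L1 W4.5a] Support file (`--supports stmt-ResolutionOfSingularities-15315 --as helper`); generic over the Literature `frobeniusNorm`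
(`Literature/AlgebraicGeometry/Resolution/FrobeniusNormIdeal.lean`); def-free, unconditional. AI-written (AI review is weaker than expert review).

Setting: `F = K^q ⊆ K` (`iterateFrobeniusRange K p e`, `q = p^e`), `β` an `F`-basis of `K` indexed by `ι` (`r = |ι|`), `A → K` an algebra.
ROOT COORDINATES are supplied as data + hypothesis (no definition): `ρ : K → ι → K` with `(ρ x i)^q = β.repr x i`; some `ρ` always exists
(`exists_rootCoords`), and a user who knows the `q`-th roots of the coordinates of his generators uses his own.

* §1 (pure multilinear algebra, any algebra `R → S`): `det_mem_span_of_rows_mem_span` — if the rows of a square matrix lie in the `R`-span of rows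
  `G₁ … G_N`, its determinant lies in the `R`-span of the determinants `det(G ∘ σ)`, `σ : ι → N` (Cauchy–Binet by multilinearity,
  `MultilinearMap.map_sum` / `map_smul_univ` on `Matrix.detRowAlternating`); `span_det_rows_eq`; `span_range_det_eq_embedding` — only INJECTIVE `σ : ι ↪ N` matter
  (`Matrix.det_zero_of_row_eq`).
* §2 root coordinates: `rootCoords_add/_zero/_sum`, `rootCoords_frob_mul` (`ρ (c^q x) = c • ρ x`), `coe_det_eq_det_rootCoords_pow` (`det_β(v) = det(ρ ∘ v)^q`),
  ★ `mem_frobeniusNormSet_iff_det` (`d ∈ normSet ↔ d = det` of the root-coordinate ROWS of an `r`-tuple from `A`), `range_rootCoords_eq_span` (under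
  `A = Σ_j A^q g_j`: the root rows of `A` are exactly the `A`-submodule of `K^ι` generated by the rows `ρ(g_j)`).
* §3 ★★ `frobeniusNorm_eq_span_maximalMinors (hρ) (g) (hg) : frobeniusNorm β A = span_A {det (ρ(g_{σ i}))_{i} : σ : ι ↪ N}` — the norm module is the
  `A`-span of the maximal minors of the `N × r` root-coordinate matrix of the `A^q`-generators `g` (and the `σ : ι → N` form).

[folklore; cite: Villamayoru2006, §2 p. 123 (norm of an `A`-submodule via `r × r` minors)]
-/

noncomputable section

open Literature.AlgebraicGeometry.Resolution

namespace Summit.ResolutionOfSingularities.ResolutionOfSingularities.Theorems.FInjectiveMacaulayfication.FrobeniusNormMinors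

set_option linter.dupNamespace false

/-! ## §1 Determinants of matrices whose rows lie in a span -/

section Multilinear

variable {R S : Type*} [CommRing R] [CommRing S] [Algebra R S] {ι N : Type*} [Fintype ι] [DecidableEq ι] [Fintype N]

/-- **Cauchy–Binet by multilinearity.** If every row of `v` lies in the `R`-span of the rows `G j`, then `det v` lies in the `R`-span of the
determinants `det (G ∘ σ)`, `σ : ι → N`. [folklore] -/
theorem det_mem_span_of_rows_mem_span (G : N → ι → S) (v : ι → ι → S) (hv : ∀ i, v i ∈ Submodule.span R (Set.range G)) :
    (Matrix.of v).det ∈ Submodule.span R (Set.range fun σ : ι → N => (Matrix.of fun i => G (σ i)).det) := by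
  classical
  choose c hc using fun i => (Submodule.mem_span_range_iff_exists_fun R).mp (hv i)
  have hv' : v = fun i => ∑ j, algebraMap R S (c i j) • G j := by
    funext i
    rw [← hc i]
    exact Finset.sum_congr rfl fun j _ => (algebraMap_smul S (c i j) (G j)).symm
  let f : MultilinearMap S (fun _ : ι => ι → S) S := (Matrix.detRowAlternating : (ι → S) [⋀^ι]→ₗ[S] S).toMultilinearMap
  have hf : ∀ w : ι → ι → S, (Matrix.of w).det = f w := fun w => rfl
  have key : (Matrix.of v).det = ∑ σ : ι → N, (∏ i, algebraMap R S (c i (σ i))) • (Matrix.of fun i => G (σ i)).det := by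
    rw [hf, hv', MultilinearMap.map_sum f fun i j => algebraMap R S (c i j) • G j]
    exact Finset.sum_congr rfl fun σ _ => by rw [hf]; exact f.map_smul_univ (fun i => algebraMap R S (c i (σ i))) fun i => G (σ i)
  rw [key]
  refine Submodule.sum_mem _ fun σ _ => ?_
  rw [← map_prod, algebraMap_smul]
  exact Submodule.smul_mem _ _ (Submodule.subset_span ⟨σ, rfl⟩)

/-- The `R`-span of the determinants of square matrices with rows in `span_R {G j}` equals the `R`-span of the `det (G ∘ σ)`, `σ : ι → N`. [folklore] -/
theorem span_det_rows_eq (G : N → ι → S) :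
    Submodule.span R {d : S | ∃ v : ι → ι → S, (∀ i, v i ∈ Submodule.span R (Set.range G)) ∧ d = (Matrix.of v).det} =
      Submodule.span R (Set.range fun σ : ι → N => (Matrix.of fun i => G (σ i)).det) := by
  refine le_antisymm (Submodule.span_le.mpr ?_) (Submodule.span_mono ?_)
  · rintro d ⟨v, hv, rfl⟩
    exact det_mem_span_of_rows_mem_span G v hv
  · rintro d ⟨σ, rfl⟩
    exact ⟨fun i => G (σ i), fun i => Submodule.subset_span ⟨σ i, rfl⟩, rfl⟩

omit [Fintype N] in
/-- Non-injective selections give determinant `0`, so only embeddings `σ : ι ↪ N` (maximal minors, in every row order) are needed. [folklore] -/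
theorem span_range_det_eq_embedding (G : N → ι → S) :
    Submodule.span R (Set.range fun σ : ι → N => (Matrix.of fun i => G (σ i)).det) =
      Submodule.span R (Set.range fun σ : ι ↪ N => (Matrix.of fun i => G (σ i)).det) := by
  refine le_antisymm (Submodule.span_le.mpr ?_) (Submodule.span_mono ?_)
  · rintro d ⟨σ, rfl⟩
    by_cases hσ : Function.Injective σ
    · exact Submodule.subset_span ⟨⟨σ, hσ⟩, rfl⟩
    · obtain ⟨i, j, hij, hne⟩ := Function.not_injective_iff.mp hσ
      have h0 : (Matrix.of fun i => G (σ i)).det = 0 :=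
        Matrix.det_zero_of_row_eq hne (by ext l; simp [hij])
      simp only [h0, SetLike.mem_coe, Submodule.zero_mem]
  · rintro d ⟨σ, rfl⟩
    exact ⟨σ, rfl⟩

omit [Fintype N] in
/-- Reordering the rows of a selection changes the minor by the sign of the permutation (bookkeeping between two enumerations of one `r`-subset). -/
theorem det_rows_comp_perm (G : N → ι → S) (σ : ι → N) (τ : Equiv.Perm ι) :
    (Matrix.of fun i => G (σ (τ i))).det = Equiv.Perm.sign τ * (Matrix.of fun i => G (σ i)).det := by
  rw [← Matrix.det_permute]
  rfl

end Multilinear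

/-! ## §2 Root coordinates and the norm set -/

section Root

universe u v

variable {K : Type u} [Field K] {p : ℕ} [ExpChar K p] {e : ℕ}
variable {ι : Type v} (β : Module.Basis ι (iterateFrobeniusRange K p e) K)
variable {A : Type*} [CommRing A] [Algebra A K]

/-- Root coordinates exist: every `β`-coordinate is a `q`-th power. -/
theorem exists_rootCoords : ∃ ρ : K → ι → K, ∀ x i, ρ x i ^ p ^ e = ((β.repr x i : iterateFrobeniusRange K p e) : K) := by
  have h : ∀ (x : K) (i : ι), ∃ y : K, y ^ p ^ e = ((β.repr x i : iterateFrobeniusRange K p e) : K) := fun x i =>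
    mem_iterateFrobeniusRange_iff.mp (β.repr x i).2
  choose ρ hρ using h
  exact ⟨ρ, hρ⟩

variable {β} {ρ : K → ι → K}

/-- Root coordinates are additive. -/
theorem rootCoords_add (hρ : ∀ x i, ρ x i ^ p ^ e = ((β.repr x i : iterateFrobeniusRange K p e) : K)) (x y : K) :
    ρ (x + y) = ρ x + ρ y := by
  funext i
  apply pow_expChar_pow_injective (K := K) (p := p) (e := e)
  dsimp only
  rw [Pi.add_apply, add_pow_expChar_pow, hρ, hρ, hρ, map_add, Finsupp.add_apply, AddMemClass.coe_add]

/-- Root coordinates of `0`. -/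
theorem rootCoords_zero (hρ : ∀ x i, ρ x i ^ p ^ e = ((β.repr x i : iterateFrobeniusRange K p e) : K)) : ρ 0 = 0 := by
  have h := rootCoords_add hρ 0 0
  rw [add_zero] at h
  funext i
  have hi := congrFun h i
  rw [Pi.add_apply] at hi
  have : ρ 0 i + ρ 0 i = ρ 0 i + 0 := by rw [add_zero]; exact hi.symm
  exact add_left_cancel this

/-- Root coordinates of a finite sum. -/
theorem rootCoords_sum (hρ : ∀ x i, ρ x i ^ p ^ e = ((β.repr x i : iterateFrobeniusRange K p e) : K)) {N : Type*} (s : Finset N)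
    (x : N → K) : ρ (∑ j ∈ s, x j) = ∑ j ∈ s, ρ (x j) := by
  let ρ' : K →+ (ι → K) := { toFun := ρ, map_zero' := rootCoords_zero hρ, map_add' := rootCoords_add hρ }
  exact map_sum ρ' x s

/-- `Frobenius semilinearity`: `ρ (c^q · x) = c · ρ x`. -/
theorem rootCoords_frob_mul (hρ : ∀ x i, ρ x i ^ p ^ e = ((β.repr x i : iterateFrobeniusRange K p e) : K)) (c x : K) :
    ρ (c ^ p ^ e * x) = c • ρ x := by
  funext i
  apply pow_expChar_pow_injective (K := K) (p := p) (e := e)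
  dsimp only
  have hk : c ^ p ^ e * x = (⟨c ^ p ^ e, mem_iterateFrobeniusRange_iff.mpr ⟨c, rfl⟩⟩ : iterateFrobeniusRange K p e) • x := rfl
  rw [Pi.smul_apply, smul_eq_mul, mul_pow, hρ, hρ, hk, map_smul, Finsupp.smul_apply, smul_eq_mul, MulMemClass.coe_mul]

/-- `ρ (algebraMap (c^q) · x) = c • ρ x` for `c ∈ A`. -/
theorem rootCoords_algebraMap_pow_mul (hρ : ∀ x i, ρ x i ^ p ^ e = ((β.repr x i : iterateFrobeniusRange K p e) : K)) (c : A) (x : K) :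
    ρ (algebraMap A K (c ^ p ^ e) * x) = c • ρ x := by
  rw [map_pow, rootCoords_frob_mul hρ, algebraMap_smul]

variable [Fintype ι] [DecidableEq ι]

/-- `det_β(v)` (an element of `K^q`) is the `q`-th power of the determinant of the root-coordinate ROWS of `v`. [folklore] -/
theorem coe_det_eq_det_rootCoords_pow (hρ : ∀ x i, ρ x i ^ p ^ e = ((β.repr x i : iterateFrobeniusRange K p e) : K)) (v : ι → K) :
    ((β.det v : iterateFrobeniusRange K p e) : K) = (Matrix.of fun j => ρ (v j)).det ^ p ^ e := by
  have h1 : (Matrix.of fun j => ρ (v j)).det = (Matrix.of fun i j => ρ (v j) i).det := by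
    rw [← Matrix.det_transpose]
    rfl
  rw [h1, Module.Basis.det_apply, ← iterateFrobenius_def, RingHom.map_det,
    show (((β.toMatrix v).det : iterateFrobeniusRange K p e) : K) = (iterateFrobeniusRange K p e).subtype (β.toMatrix v).det from rfl,
    RingHom.map_det]
  congr 1
  ext i j
  simp only [RingHom.mapMatrix_apply, Matrix.map_apply, Module.Basis.toMatrix_apply, Matrix.of_apply, iterateFrobenius_def, hρ]
  rfl

/-- ★ **The norm set in root coordinates**: `d ∈ frobeniusNormSet β A` iff `d` is the determinant of the root-coordinate rows of an `r`-tuple from `A`.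
[folklore; cite: Villamayoru2006, §2 p. 123] -/
theorem mem_frobeniusNormSet_iff_det (hρ : ∀ x i, ρ x i ^ p ^ e = ((β.repr x i : iterateFrobeniusRange K p e) : K)) {d : K} :
    d ∈ frobeniusNormSet β A ↔ ∃ m : ι → A, d = (Matrix.of fun j => ρ (algebraMap A K (m j))).det := by
  rw [mem_frobeniusNormSet_iff]
  refine exists_congr fun m => ?_
  rw [coe_det_eq_det_rootCoords_pow hρ]
  exact (pow_expChar_pow_injective (K := K) (p := p) (e := e)).eq_iff

omit [Fintype ι] [DecidableEq ι] in
/-- **Root rows of `A` = the `A`-submodule generated by the root rows of a set of `A^q`-generators.** Hypothesis `hg`: `A = Σ_j A^q · g_j`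
(e.g. `A` essentially of finite type over a perfect field, `g` = monomials with exponents `< q`). [folklore] -/
theorem range_rootCoords_eq_span (hρ : ∀ x i, ρ x i ^ p ^ e = ((β.repr x i : iterateFrobeniusRange K p e) : K)) {N : Type*} [Fintype N]
    (g : N → A) (hg : ∀ a : A, ∃ c : N → A, a = ∑ j, c j ^ p ^ e * g j) :
    Set.range (fun a : A => ρ (algebraMap A K a)) = (Submodule.span A (Set.range fun j => ρ (algebraMap A K (g j))) : Set (ι → K)) := by
  have hexp : ∀ c : N → A, ρ (algebraMap A K (∑ j, c j ^ p ^ e * g j)) = ∑ j, c j • ρ (algebraMap A K (g j)) := by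
    intro c
    rw [map_sum, rootCoords_sum hρ]
    exact Finset.sum_congr rfl fun j _ => by rw [map_mul, rootCoords_algebraMap_pow_mul hρ]
  ext w
  constructor
  · rintro ⟨a, rfl⟩
    obtain ⟨c, rfl⟩ := hg a
    change ρ (algebraMap A K (∑ j, c j ^ p ^ e * g j)) ∈ _
    rw [hexp, SetLike.mem_coe]
    exact Submodule.sum_mem _ fun j _ => Submodule.smul_mem _ _ (Submodule.subset_span ⟨j, rfl⟩)
  · intro hw
    obtain ⟨c, rfl⟩ := (Submodule.mem_span_range_iff_exists_fun A).mp hw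
    exact ⟨∑ j, c j ^ p ^ e * g j, hexp c⟩

/-! ## §3 The norm module as the span of maximal minors -/

/-- The norm set, rewritten: determinants of square matrices whose rows lie in the `A`-span of the root rows of the generators. -/
theorem frobeniusNormSet_eq_det_rows (hρ : ∀ x i, ρ x i ^ p ^ e = ((β.repr x i : iterateFrobeniusRange K p e) : K)) {N : Type*} [Fintype N]
    (g : N → A) (hg : ∀ a : A, ∃ c : N → A, a = ∑ j, c j ^ p ^ e * g j) :
    frobeniusNormSet β A = {d : K | ∃ v : ι → ι → K,
      (∀ i, v i ∈ Submodule.span A (Set.range fun j => ρ (algebraMap A K (g j)))) ∧ d = (Matrix.of v).det} := by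
  have hrange := range_rootCoords_eq_span hρ g hg
  ext d
  rw [mem_frobeniusNormSet_iff_det hρ, Set.mem_setOf_eq]
  constructor
  · rintro ⟨m, rfl⟩
    refine ⟨fun j => ρ (algebraMap A K (m j)), fun j => ?_, rfl⟩
    rw [← SetLike.mem_coe, ← hrange]
    exact ⟨m j, rfl⟩
  · rintro ⟨v, hv, rfl⟩
    have hv' : ∀ j, ∃ a : A, ρ (algebraMap A K a) = v j := fun j => by
      have := hv j
      rw [← SetLike.mem_coe, ← hrange] at this
      exact this
    choose m hm using hv'
    refine ⟨m, ?_⟩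
    congr 1
    ext j l
    simp only [Matrix.of_apply, hm]

/-- ★★ **The Frobenius norm module is the `A`-span of the maximal minors of the root-coordinate matrix of the `A^q`-generators** (all selections
`σ : ι → N`). [folklore; cite: Villamayoru2006, §2 p. 123] -/
theorem frobeniusNorm_eq_span_det (hρ : ∀ x i, ρ x i ^ p ^ e = ((β.repr x i : iterateFrobeniusRange K p e) : K)) {N : Type*} [Fintype N]
    (g : N → A) (hg : ∀ a : A, ∃ c : N → A, a = ∑ j, c j ^ p ^ e * g j) :
    frobeniusNorm β A = Submodule.span A (Set.range fun σ : ι → N => (Matrix.of fun i => ρ (algebraMap A K (g (σ i)))).det) := by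
  rw [frobeniusNorm, frobeniusNormSet_eq_det_rows hρ g hg, span_det_rows_eq]

/-- ★★ **Same, with injective selections only** (`σ : ι ↪ N`: the maximal minors of the `N × r` root-coordinate matrix, each in every row order).
[folklore; cite: Villamayoru2006, §2 p. 123] -/
theorem frobeniusNorm_eq_span_maximalMinors (hρ : ∀ x i, ρ x i ^ p ^ e = ((β.repr x i : iterateFrobeniusRange K p e) : K)) {N : Type*}
    [Fintype N] (g : N → A) (hg : ∀ a : A, ∃ c : N → A, a = ∑ j, c j ^ p ^ e * g j) :
    frobeniusNorm β A = Submodule.span A (Set.range fun σ : ι ↪ N => (Matrix.of fun i => ρ (algebraMap A K (g (σ i)))).det) := by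
  rw [frobeniusNorm_eq_span_det hρ g hg]
  exact span_range_det_eq_embedding (R := A) fun j => ρ (algebraMap A K (g j))

/-! ## §4 (appended) Root rows given explicitly: no global `ρ` needed -/

omit [Fintype ι] [DecidableEq ι] in
/-- Uniqueness of root coordinates: if `x = Σ_i w_i^q · β_i` then `ρ x = w`. -/
theorem rootCoords_apply_eq_of_eq_sum [Fintype ι] (hρ : ∀ x i, ρ x i ^ p ^ e = ((β.repr x i : iterateFrobeniusRange K p e) : K))
    {x : K} (w : ι → K) (hw : x = ∑ i, w i ^ p ^ e * β i) : ρ x = w := by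
  funext i
  apply pow_expChar_pow_injective (K := K) (p := p) (e := e)
  dsimp only
  rw [hρ]
  let c : ι → iterateFrobeniusRange K p e := fun i => ⟨w i ^ p ^ e, mem_iterateFrobeniusRange_iff.mpr ⟨w i, rfl⟩⟩
  have hx : x = ∑ i, c i • β i := by
    rw [hw]
    exact Finset.sum_congr rfl fun i _ => rfl
  rw [hx, β.repr_sum_self]

/-- ★★ **The norm module from EXPLICIT root rows of the generators**: if `A = Σ_j A^q g_j` and `g_j = Σ_i (G j i)^q β_i` in `K` (so `G j` is the root-coordinate row of
`g_j`), then `[[F^e_* A]]_β = span_A {det (G (σ i))_{i} : σ : ι → N}` — the user supplies the `N × r` matrix `G` and checks the `N` expansions, nothing else.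
[folklore; cite: Villamayoru2006, §2 p. 123] -/
theorem frobeniusNorm_eq_span_det_of_rootRows {N : Type*} [Fintype N] (g : N → A) (hg : ∀ a : A, ∃ c : N → A, a = ∑ j, c j ^ p ^ e * g j)
    (G : N → ι → K) (hG : ∀ j, algebraMap A K (g j) = ∑ i, G j i ^ p ^ e * β i) :
    frobeniusNorm β A = Submodule.span A (Set.range fun σ : ι → N => (Matrix.of fun i => G (σ i)).det) := by
  obtain ⟨ρ, hρ⟩ := exists_rootCoords β
  have hGρ : ∀ j, ρ (algebraMap A K (g j)) = G j := fun j => rootCoords_apply_eq_of_eq_sum hρ (G j) (hG j)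
  rw [frobeniusNorm_eq_span_det hρ g hg]
  simp only [hGρ]

/-- ★★ Same with injective selections `σ : ι ↪ N` (maximal minors of the explicit root-row matrix `G`). -/
theorem frobeniusNorm_eq_span_maximalMinors_of_rootRows {N : Type*} [Fintype N] (g : N → A)
    (hg : ∀ a : A, ∃ c : N → A, a = ∑ j, c j ^ p ^ e * g j) (G : N → ι → K) (hG : ∀ j, algebraMap A K (g j) = ∑ i, G j i ^ p ^ e * β i) :
    frobeniusNorm β A = Submodule.span A (Set.range fun σ : ι ↪ N => (Matrix.of fun i => G (σ i)).det) := by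
  rw [frobeniusNorm_eq_span_det_of_rootRows g hg G hG]
  exact span_range_det_eq_embedding (R := A) G

end Root

end Summit.ResolutionOfSingularities.ResolutionOfSingularities.Theorems.FInjectiveMacaulayfication.FrobeniusNormMinors

end
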